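import Summits.AnomalousDissipation.AnomalousDissipation.Theorems.SolenoidalFractalHomogenisationLagrangianStepDefs
import Summits.AnomalousDissipation.AnomalousDissipation.Theorems.SolenoidalFractalHomogenisationRealisedQuasiStaticCellLawSectorReduction
import Literature.Analysis.FunctionSpaces.TorusTrigPoly
import HarnessLib

/-!
# K1L_D `LagrangianRenormalisationStepDesign` (stmt-AnomalousDissipation-27980), stub `stub_oneLevelL_IW` v3: the SHARED DATA DEFINITIONS of the
# one-level split (helper; `--supports stmt-AnomalousDissipation-27980`; tenure D24-8 (a))

Summits-side definitions file of route `SolenoidalFractalHomogenisation`, namespace `…Theorems.SolenoidalFractalHomogenisation.LagrangianStep` (the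
namespace of the first two shared-defs files `…LagrangianStepDefs` p610007 / `…LagrangianStepOneLevelDefs`; it imports the first): the five data
definitions over which the v3 cut of the registered stub `stub_oneLevelL_IW` (registry v2′, K1L_D) is stated — block §0 of the consented reference text
`Summits/AnomalousDissipation/AnomalousDissipation/Cruxes/LagrangianRenormalisationStep/OneLevelSplitSketch.lean` (planner ad-ideate-p4 g11, commits
e1519d1cbcbd / 9659140a23cd; lead consent 2026-08-28T15:52:03Z; tenure D24-7 / D24-8), copied VERBATIM (same short names, bodies, binder order):

* `V2` — the Hilbert space `L²(𝕋³; ℝ³)` as Mathlib's `Lp (EuclideanSpace ℝ (Fin 3)) 2 volume` (ALL of `L²`, no solenoidal submodule: the window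
  maps are extended by `0` off the weakly divergence-free classes, so the energy ledger's `adjoint` is the plain `L²` adjoint);
* `datumLp w₀ hw₀ : V2` — an `IsDatum` (`H¹`, mean zero, weakly divergence free) read in `V2` (`MemLp _ 2` by
  `RealisedQuasiStaticCellLaw.memLp_two_of_memSobolev_one_complexify`);
* `grid r t k = min (k·r) t` — the refresh grid of width `r` clipped at the observation time `t` (`grid r t 0 = 0`, `grid r t (⌊t/r⌋₊+1) = t`;
  windows past `t` are degenerate, which the uniform-in-`k` hypotheses of the energy ledger `window_ledger_abs` (p645039) tolerate);
* `cutLp N y` — the sharp Fourier cut-off `Torus.fourierTruncate N` (closed frequency ball of radius `N`) read on `V2`;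
* `vSeq Um w₀ r t`, `uSeq Um1 w₀ N r t : ℕ → V2` — the grid values of the reference evolution `U^m(0,·)w₀` and of the CUT actual evolution
  `P_{≤N} U^{m+1}(0,·)w₀` (both `w₀` at index `0`): the two sequences fed to `window_ledger_abs`.

The two-parameter window-propagator spec `IsPropagator T b 𝔸 U` (S0′) is NOT defined here: it has ONE home, Literature-side and generic in the
dimension, in the S0′ taker's file (prover ad-k3l-bookkeeping-p1 g4; tenure consent 2026-08-28T15:40:37Z); the glue file
`…LagrangianStepOneLevelSplitGlue` (tenure D24-8 (b): `oneLevelL_IW_of_pieces : S0′ → S23′ → S3d′ → (stub_oneLevelL_IW text)`) imports both.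
Definitions only — no theorems, no named facts, no instances, no notation.  WHAT THIS IS NOT: not a proof of any stub, of the crux K1L_D, of
Onsager's conjecture or of anomalous dissipation; rung F-D1.A0 infrastructure.  Planner seat `ad-ideate-p4` g11, 2026-08-28.
-/

set_option linter.dupNamespace false

namespace Summit.AnomalousDissipation.AnomalousDissipation.Theorems.SolenoidalFractalHomogenisation.LagrangianStep

open Literature.Analysis Literature.Analysis.FluidPDE Literature.Analysis.FunctionSpaces
open MeasureTheory Set Filter
open scoped ENNReal NNReal InnerProductSpace
open Summit.AnomalousDissipation.AnomalousDissipation.Theorems.SolenoidalFractalHomogenisation.RealisedQuasiStaticCellLaw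
  (memLp_two_of_memSobolev_one_complexify)

noncomputable section

/-- The ledger's Hilbert space: all of `L²(𝕋³; ℝ³)`. -/
abbrev V2 : Type := Lp (EuclideanSpace ℝ (Fin 3)) 2 (volume : Measure (UnitAddTorus (Fin 3)))

/-- An admissible datum read in `V2`. -/
def datumLp (w₀ : VF) (hw₀ : IsDatum w₀) : V2 :=
  (memLp_two_of_memSobolev_one_complexify hw₀.1).toLp w₀

/-- The ledger grid at terminal time `t` for window length `r`: `w_k = min (k·r) t`. -/
def grid (r t : ℝ) (k : ℕ) : ℝ := min ((k : ℝ) * r) t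

/-- The Fourier cut `P_{≤N}` (scalar ball `|ℓ| ≤ N`) read on `V2`. -/
def cutLp (N : ℕ) (y : V2) : V2 :=
  (Torus.memLp_fourierTruncate N (y : VF) 2).toLp (Torus.fourierTruncate N (y : VF))

/-- The EXACT ledger sequence `v_k := U^m_{0 → w_k} w₀` (`v_0 := w₀`). -/
def vSeq (Um : ℝ → ℝ → (V2 →L[ℝ] V2)) (w0L : V2) (r t : ℝ) : ℕ → V2
  | 0 => w0L
  | j + 1 => Um 0 (grid r t (j + 1)) w0L

/-- The PERTURBED ledger sequence `u_0 := w₀`, `u_k := P_{≤N} U^{m+1}_{0 → w_k} w₀` (`k ≥ 1`). -/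
def uSeq (Um1 : ℝ → ℝ → (V2 →L[ℝ] V2)) (w0L : V2) (N : ℕ) (r t : ℝ) : ℕ → V2
  | 0 => w0L
  | j + 1 => cutLp N (Um1 0 (grid r t (j + 1)) w0L)

end

end Summit.AnomalousDissipation.AnomalousDissipation.Theorems.SolenoidalFractalHomogenisation.LagrangianStep
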